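import Summits.Ventures.PercRepro.RankLevelSetNumGe
import Summits.Ventures.PercRepro.RankLevelSetNumGeExc

/-!
# PercRepro — `num_ge` FOR EVERY `q ≤ 18` (night-1, gen 10; dossier §20.6)

The termwise scheme of RankLevelSetNumGe, run with `q ≤ 18`: the polynomial facts (I1), (I2), (I2′) hold for all cells
(`poly_I1_18`, `poly_I2_18`, `poly_I2'_18`), and (I3), (I3′) — the binding index `(1,1)` — hold away from the small cells
(`a = p − k − 1 ≥ 11`: `poly_I3_18_big`, `poly_I3'_18_big`) and, on the small cells, at every cell NOT in `excList`
(`poly_I3_18_small`, `poly_I3'_18_small`, a finite check).  The 37 exceptional cells are the direct instances of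
RankLevelSetNumGeExc.  The case lemmas of RankLevelSetNumGe are re-stated with the polynomial facts as hypotheses
(`demBA_le_nuTerm_of`, `demAC_le_nuTerm_of`, `demD_le_nuTerm_of`).

Axioms: standard.
-/

namespace PercRepro

open Finset

/-- (I1) with `q ≤ 18`. -/
lemma poly_I1_18 (a j k q : ℕ) (hq : q ≤ 18) (hk1 : 1 ≤ k) (hkq : k ≤ q) (hj : 2 ≤ j) (ha : q + 3 ≤ a + k) :
    (q + j + 1 + k * (j + 1)) * a + (a + j) * (j + 1) ≤ (a + j) * (a + k) * (j + 1) := by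
  obtain ⟨k', rfl⟩ : ∃ k', k = k' + 1 := ⟨k - 1, by omega⟩
  have ha3 : 3 ≤ a := by omega
  rcases Nat.lt_or_ge a 4 with h4 | h4
  · have : a = 3 := by omega
    subst this
    have hk' : q ≤ k' + 1 := by omega
    nlinarith [Nat.mul_le_mul hj hj, Nat.mul_le_mul_left j hj]
  · rcases Nat.lt_or_ge a 7 with h7 | h7
    · nlinarith [Nat.mul_le_mul h4 hj, Nat.mul_le_mul_left a hj, Nat.mul_le_mul_left j h4,
        Nat.mul_le_mul_left k' hj, Nat.mul_le_mul_left (a * k') hj, Nat.mul_le_mul_left j hj]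
    · nlinarith [Nat.mul_le_mul h7 hj, Nat.mul_le_mul_left a hj, Nat.mul_le_mul_left j h7,
        Nat.mul_le_mul_left k' hj, Nat.mul_le_mul_left (a * k') hj]

/-- (I2) with `q ≤ 18`. -/
lemma poly_I2_18 (a s k q : ℕ) (hq : q ≤ 18) (hkq : k + 1 ≤ q) (hs : 2 ≤ s) (hsk : s ≤ k) (ha : s + 3 ≤ a) :
    k * a * (s + 1) + k * (q + s + 1) ≤ (a + 1) * (a + 1 + k + q) * (s + 1) := by
  nlinarith [Nat.mul_le_mul_left k hs, Nat.mul_le_mul_left a hs, Nat.mul_le_mul ha hs,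
    Nat.mul_le_mul_left (k * s) ha, Nat.mul_le_mul_left q hs]

/-- (I2′) with `q ≤ 18`. -/
lemma poly_I2'_18 (a s k q : ℕ) (hq : q ≤ 18) (hkq : k + 1 ≤ q) (hs : 2 ≤ s) (hsk : s ≤ k) (ha : s + 2 ≤ a) :
    k * (q + s + 1) ≤ (a + 1) * (a + 1 + k + q) * (s + 1) := by
  nlinarith [Nat.mul_le_mul ha hs, Nat.mul_le_mul_left k hs, Nat.mul_le_mul_left q hs]

/-- (I3) with `q ≤ 18` away from the small cells: `a ≥ 11`. -/
lemma poly_I3_18_big (a k q : ℕ) (hq : q ≤ 18) (hkq : k + 1 ≤ q) (ha : 11 ≤ a) :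
    a * (q + 2) + 2 * k * a + k * (q + 2) ≤ 2 * (a + 1) * (a + 1 + k + q) := by
  nlinarith [Nat.mul_le_mul_left q ha, Nat.mul_le_mul_right k hq, Nat.mul_le_mul ha ha]

/-- (I3′) with `q ≤ 18` away from the small cells: `a ≥ 11`. -/
lemma poly_I3'_18_big (a k q : ℕ) (hq : q ≤ 18) (hkq : k + 1 ≤ q) (ha : 11 ≤ a) :
    a * (q + 2) + k * (q + 2) ≤ 2 * (a + 1) * (a + 1 + k + q) := by
  nlinarith [Nat.mul_le_mul_left q ha, Nat.mul_le_mul_right k hq, Nat.mul_le_mul_left k ha]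

/-- (I3) on the small cells `4 ≤ a ≤ 10`, `11 ≤ q ≤ 18`, away from `excList` (`p = a + k + 1`). -/
lemma poly_I3_18_small (a k q : ℕ) (hq11 : 11 ≤ q) (hq : q ≤ 18) (hk1 : 1 ≤ k) (hkq : k < q) (ha4 : 4 ≤ a)
    (ha : a ≤ 10) (hpk : q + 3 ≤ a + k) (hnot : (a + k + 1, q, k) ∉ excList) :
    a * (q + 2) + 2 * k * a + k * (q + 2) ≤ 2 * (a + 1) * (a + 1 + k + q) := by
  interval_cases a <;> interval_cases q <;> interval_cases k <;>
    first | omega | exact absurd (by decide) hnot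

/-- (I3′) on the small cells `3 ≤ a ≤ 10`, `11 ≤ q ≤ 18`, `p = q + 3`, away from `excList`. -/
lemma poly_I3'_18_small (a k q : ℕ) (hq11 : 11 ≤ q) (hq : q ≤ 18) (hk1 : 1 ≤ k) (hkq : k < q) (ha3 : 3 ≤ a)
    (ha : a ≤ 10) (hpk : a + k = q + 2) (hnot : (a + k + 1, q, k) ∉ excList) :
    a * (q + 2) + k * (q + 2) ≤ 2 * (a + 1) * (a + 1 + k + q) := by
  interval_cases a <;> interval_cases q <;> interval_cases k <;>
    first | omega | exact absurd (by decide) hnot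

/-- Case (B) with the polynomial fact (I1) as a hypothesis. -/
lemma demBA_le_nuTerm_of {p q k j : ℕ} (hpq : q + 2 ≤ p) (hk1 : 1 ≤ k) (hkq : k ≤ q)
    (hj2 : 2 ≤ j) (hjd : j ≤ p - q - 1)
    (hI1 : j + 3 ≤ p - q → (q + j + 1 + k * (j + 1)) * (p - k - j) + (p - k - j + j) * (j + 1) ≤
      (p - k - j + j) * (p - k - j + k) * (j + 1)) :
    demB p q k j + demA p q k 1 j ≤ nuTerm p q k 1 j := by
  have hk : k + 1 ≤ p := by omega
  have hjp : 1 + j ≤ p := by omega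
  have hpj : (1 : ℚ) + j ≤ p := by exact_mod_cast hjp
  have hw : (0 : ℚ) ≤ (p : ℚ) - 1 - j := by linarith
  unfold nuTerm wbar
  rw [if_neg (by omega : j ≠ 1), Nat.choose_one_right]
  have hm0 := mbar_pos_q q k 1 j
  have hm : (mbar q k 1 j : ℚ) ≤ ((q + 1 + j).choose q : ℚ) := by exact_mod_cast mbar_le_choose q k 1 j
  have hν : (k : ℚ) * ((p - k).choose j : ℚ) * ((p : ℚ) - 1 - j) / ((q + 1 + j).choose q : ℚ) ≤
      (k : ℚ) * ((p - k).choose j : ℚ) * ((p : ℚ) - 1 - j) / (mbar q k 1 j : ℚ) :=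
    div_le_div_of_nonneg_left (by positivity) hm0 hm
  refine le_trans ?_ hν
  have hX : (0 : ℚ) < ((q + j).choose q : ℚ) := by exact_mod_cast Nat.choose_pos (by omega)
  have hY : (0 : ℚ) < ((q + 1 + j).choose q : ℚ) := by exact_mod_cast Nat.choose_pos (by omega)
  have hXY : ((q + 1 + j).choose q : ℚ) * ((j : ℚ) + 1) = ((q + j).choose q : ℚ) * ((q : ℚ) + j + 1) := by
    rw [show q + 1 + j = q + j + 1 by ring]
    exact choose_q_succ_mul q j
  have hB0 : (0 : ℚ) ≤ ((p - k - 1).choose j : ℚ) := by positivity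
  have hB' : (0 : ℚ) ≤ ((p - k).choose j : ℚ) := by positivity
  have hBle : ((p - k - 1).choose j : ℚ) ≤ ((p - k).choose j : ℚ) := by
    exact_mod_cast choose_pred_le hk j
  unfold demB demA
  split_ifs with h1 h2
  · -- both charges: `j + 2 ≤ d` and `j + 3 ≤ d`
    have hBB := choose_pred_mul hk (by omega : j ≤ p - k)
    have hI := hI1 (by omega)
    have hIq : (((q + j + 1 + k * (j + 1)) * (p - k - j) + (p - k - j + j) * (j + 1) : ℕ) : ℚ) ≤
        (((p - k - j + j) * (p - k - j + k) * (j + 1) : ℕ) : ℚ) := by exact_mod_cast hI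
    push_cast [Nat.cast_sub (show j ≤ p - k by omega), Nat.cast_sub (show k ≤ p by omega)] at hIq
    have hI1 : ((q : ℚ) + j + 1 + k * (j + 1)) * ((p : ℚ) - k - j) ≤
        ((p : ℚ) - k) * ((p : ℚ) - 1 - j) * (j + 1) := by nlinarith [hIq]
    have hpkj : (0 : ℚ) < (p : ℚ) - k - j := by
      have : k + j + 1 ≤ p := by omega
      have : (k : ℚ) + j + 1 ≤ p := by exact_mod_cast this
      linarith
    have hcore := coreB ((p - k - 1).choose j : ℚ) ((p - k).choose j : ℚ) ((q + j).choose q : ℚ)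
      ((q + 1 + j).choose q : ℚ) k p q j hB0 hX hY (by exact_mod_cast hk1) (by positivity) hpkj hXY hBB hI1
    calc (k : ℚ) * ((p - k - 1).choose j : ℚ) / ((q + j).choose q : ℚ) +
          (k : ℚ) * (k.choose 1 : ℚ) * ((p - k - 1).choose j : ℚ) / ((q + 1 + j).choose q : ℚ)
        = (k : ℚ) * ((p - k - 1).choose j : ℚ) / ((q + j).choose q : ℚ) +
          (k : ℚ) * k * ((p - k - 1).choose j : ℚ) / ((q + 1 + j).choose q : ℚ) := by
          rw [Nat.choose_one_right]
      _ ≤ _ := hcore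
  · -- only `demB`: `j = d − 2`, weight `q + 1`
    have hjq : (p : ℚ) - 1 - j = (q : ℚ) + 1 := by
      have : p = q + j + 2 := by omega
      subst this
      push_cast
      ring
    rw [hjq, add_zero]
    apply coreB' ((p - k - 1).choose j : ℚ) ((p - k).choose j : ℚ) ((q + j).choose q : ℚ)
      ((q + 1 + j).choose q : ℚ) k q j hB' hBle hX hY (by positivity) (by positivity) hXY
    have : (q : ℚ) * j ≥ 0 := by positivity
    nlinarith
  · exact absurd (by omega) h1
  · rw [zero_add]
    positivity

/-- Case (C) with the polynomial facts (I2), (I2′) as hypotheses. -/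
lemma demAC_le_nuTerm_of {p q k σ : ℕ} (hpq : q + 2 ≤ p) (hk1 : 1 ≤ k) (hkq : k ≤ q)
    (hσ2 : 2 ≤ σ) (_hσk : σ ≤ k)
    (hI2 : k < q → σ + 3 ≤ p - q → k * (p - k - 1) * (σ + 1) + k * (q + σ + 1) ≤
      (p - k - 1 + 1) * (p - k - 1 + 1 + k + q) * (σ + 1))
    (hI2' : k < q → σ + 2 ≤ p - q → k * (q + σ + 1) ≤ (p - k - 1 + 1) * (p - k - 1 + 1 + k + q) * (σ + 1)) :
    demA p q k σ 1 + demC p q k σ ≤ nuTerm p q k σ 1 := by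
  have hk : k + 1 ≤ p := by omega
  unfold nuTerm wbar
  rw [if_pos rfl, Nat.choose_one_right]
  push_cast
  have hA : (0 : ℚ) ≤ (k.choose σ : ℚ) := by positivity
  have hX : (0 : ℚ) < ((q + σ).choose q : ℚ) := by exact_mod_cast Nat.choose_pos (by omega)
  have hY : (0 : ℚ) < ((q + σ + 1).choose q : ℚ) := by exact_mod_cast Nat.choose_pos (by omega)
  have hXY : ((q + σ + 1).choose q : ℚ) * ((σ : ℚ) + 1) = ((q + σ).choose q : ℚ) * ((q : ℚ) + σ + 1) :=
    choose_q_succ_mul q σ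
  have hpk : ((p - k : ℕ) : ℚ) = ((p - k - 1 : ℕ) : ℚ) + 1 := by
    rw [Nat.cast_sub (show k ≤ p by omega), Nat.sub_sub, Nat.cast_sub (show k + 1 ≤ p by omega)]
    push_cast; ring
  have hn : ((p : ℚ) + q) = ((p - k - 1 : ℕ) : ℚ) + 1 + k + q := by
    rw [Nat.sub_sub, Nat.cast_sub (show k + 1 ≤ p by omega)]; push_cast; ring
  rw [hpk]
  have ha0 : (0 : ℚ) ≤ ((p - k - 1 : ℕ) : ℚ) := by positivity
  unfold demA demC
  rcases Nat.lt_or_ge k q with hlt | hge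
  · -- `k < q`: `m̄(σ,1) = C(q+σ+1,q)`
    rw [mbar_one_of_lt σ hlt]
    split_ifs with h1 h2
    · have hI := hI2 hlt (by omega)
      have hIq : ((k * (p - k - 1) * (σ + 1) + k * (q + σ + 1) : ℕ) : ℚ) ≤
          (((p - k - 1 + 1) * (p - k - 1 + 1 + k + q) * (σ + 1) : ℕ) : ℚ) := by exact_mod_cast hI
      push_cast at hIq
      have := coreC (k.choose σ : ℚ) ((q + σ).choose q : ℚ) ((q + σ + 1).choose q : ℚ)
        ((p - k - 1 : ℕ) : ℚ) k ((p : ℚ) + q) σ q hA hX hY (by positivity) hXY (by rw [hn]; exact hIq)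
      calc (k : ℚ) * (k.choose σ : ℚ) * ((p - k - 1).choose 1 : ℚ) / ((q + σ + 1).choose q : ℚ) +
            (k : ℚ) * (k.choose σ : ℚ) / ((q + σ).choose q : ℚ)
          = (k : ℚ) * (k.choose σ : ℚ) * ((p - k - 1 : ℕ) : ℚ) / ((q + σ + 1).choose q : ℚ) +
            (k : ℚ) * (k.choose σ : ℚ) / ((q + σ).choose q : ℚ) := by rw [Nat.choose_one_right]
        _ ≤ _ := this
    · exact absurd (by omega) h2
    · have hI := hI2' hlt (by omega)
      have hIq : ((k * (q + σ + 1) : ℕ) : ℚ) ≤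
          (((p - k - 1 + 1) * (p - k - 1 + 1 + k + q) * (σ + 1) : ℕ) : ℚ) := by exact_mod_cast hI
      push_cast at hIq
      rw [zero_add]
      exact coreC' (k.choose σ : ℚ) ((q + σ).choose q : ℚ) ((q + σ + 1).choose q : ℚ)
        ((p - k - 1 : ℕ) : ℚ) k ((p : ℚ) + q) σ q hA hX hY (by positivity) hXY (by rw [hn]; exact hIq)
    · rw [zero_add]; positivity
  · -- `k = q`: `m̄(σ,1) = C(q+σ,q)`
    have hkq' : k = q := le_antisymm hkq hge
    subst hkq'
    rw [mbar_one_of_eq]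
    have hXle : ((k + σ).choose k : ℚ) ≤ ((k + σ + 1).choose k : ℚ) := by
      exact_mod_cast Nat.choose_le_succ (k + σ) k
    have hkn : (k : ℚ) ≤ (p : ℚ) + k := by
      have : (0 : ℚ) ≤ p := by positivity
      linarith
    have hcore := coreQ (k.choose σ : ℚ) ((k + σ).choose k : ℚ) ((k + σ + 1).choose k : ℚ)
      ((p - k - 1 : ℕ) : ℚ) k ((p : ℚ) + k) hA hX hXle (by positivity) ha0 hkn
    split_ifs with h1 h2
    · calc (k : ℚ) * (k.choose σ : ℚ) * ((p - k - 1).choose 1 : ℚ) / ((k + σ + 1).choose k : ℚ) +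
            (k : ℚ) * (k.choose σ : ℚ) / ((k + σ).choose k : ℚ)
          = (k : ℚ) * (k.choose σ : ℚ) * ((p - k - 1 : ℕ) : ℚ) / ((k + σ + 1).choose k : ℚ) +
            (k : ℚ) * (k.choose σ : ℚ) / ((k + σ).choose k : ℚ) := by rw [Nat.choose_one_right]
        _ ≤ _ := hcore
    · exact absurd (by omega) h2
    · rw [zero_add]
      refine le_trans ?_ hcore
      have : (0 : ℚ) ≤ (k : ℚ) * (k.choose σ : ℚ) * ((p - k - 1 : ℕ) : ℚ) / ((k + σ + 1).choose k : ℚ) := by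
        positivity
      linarith
    · rw [zero_add]; positivity


/-- Case (D) with the polynomial facts (I3), (I3′) as hypotheses. -/
lemma demD_le_nuTerm_of {p q k : ℕ} (hpq : q + 2 ≤ p) (hk1 : 1 ≤ k) (hkq : k ≤ q)
    (hI3 : k < q → 4 ≤ p - q → (p - k - 1) * (q + 2) + 2 * k * (p - k - 1) + k * (q + 2) ≤
      2 * (p - k - 1 + 1) * (p - k - 1 + 1 + k + q))
    (hI3' : k < q → p - q = 3 → (p - k - 1) * (q + 2) + k * (q + 2) ≤
      2 * (p - k - 1 + 1) * (p - k - 1 + 1 + k + q)) :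
    demB p q k 1 + demA p q k 1 1 + demC p q k 1 ≤ nuTerm p q k 1 1 := by
  have hk : k + 1 ≤ p := by omega
  unfold nuTerm wbar
  rw [if_pos rfl, Nat.choose_one_right, Nat.choose_one_right]
  push_cast
  have hX : (0 : ℚ) < ((q + 1).choose q : ℚ) := by exact_mod_cast Nat.choose_pos (by omega)
  have hY : (0 : ℚ) < ((q + 1 + 1).choose q : ℚ) := by exact_mod_cast Nat.choose_pos (by omega)
  have hXY : ((q + 1 + 1).choose q : ℚ) * ((1 : ℚ) + 1) = ((q + 1).choose q : ℚ) * ((q : ℚ) + 1 + 1) := by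
    have := choose_q_succ_mul q 1
    push_cast at this
    exact this
  have hpk : ((p - k : ℕ) : ℚ) = ((p - k - 1 : ℕ) : ℚ) + 1 := by
    rw [Nat.cast_sub (show k ≤ p by omega), Nat.sub_sub, Nat.cast_sub (show k + 1 ≤ p by omega)]
    push_cast; ring
  have hn : ((p : ℚ) + q) = ((p - k - 1 : ℕ) : ℚ) + 1 + k + q := by
    rw [Nat.sub_sub, Nat.cast_sub (show k + 1 ≤ p by omega)]; push_cast; ring
  rw [hpk, hn]
  have ha0 : (0 : ℚ) ≤ ((p - k - 1 : ℕ) : ℚ) := by positivity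
  have hk0 : (0 : ℚ) < k := by exact_mod_cast hk1
  unfold demB demA demC
  try simp only [Nat.choose_one_right]
  rcases Nat.lt_or_ge k q with hlt | hge
  · rw [mbar_one_of_lt 1 hlt]
    split_ifs with h1 h2
    · have hI := hI3 hlt (by omega)
      have hIq : (((p - k - 1) * (q + 2) + 2 * k * (p - k - 1) + k * (q + 2) : ℕ) : ℚ) ≤
          ((2 * (p - k - 1 + 1) * (p - k - 1 + 1 + k + q) : ℕ) : ℚ) := by exact_mod_cast hI
      push_cast at hIq
      exact coreD ((q + 1).choose q : ℚ) ((q + 1 + 1).choose q : ℚ) ((p - k - 1 : ℕ) : ℚ) k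
        (((p - k - 1 : ℕ) : ℚ) + 1 + k + q) q hX hY hXY hk0 ha0 hIq
    · have hI := hI3' hlt (by omega)
      have hIq : (((p - k - 1) * (q + 2) + k * (q + 2) : ℕ) : ℚ) ≤
          ((2 * (p - k - 1 + 1) * (p - k - 1 + 1 + k + q) : ℕ) : ℚ) := by exact_mod_cast hI
      push_cast at hIq
      rw [add_zero]
      exact coreD' ((q + 1).choose q : ℚ) ((q + 1 + 1).choose q : ℚ) ((p - k - 1 : ℕ) : ℚ) k
        (((p - k - 1 : ℕ) : ℚ) + 1 + k + q) q hX hY hXY hk0 hIq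
    · exact absurd (by omega) h1
    · rw [zero_add, zero_add]
      positivity
  · have hkq' : k = q := le_antisymm hkq hge
    subst hkq'
    rw [mbar_one_of_eq]
    have hXle : ((k + 1).choose k : ℚ) ≤ ((k + 1 + 1).choose k : ℚ) := by
      exact_mod_cast Nat.choose_le_succ (k + 1) k
    have hkn : ((p - k - 1 : ℕ) : ℚ) * ((k : ℚ) + 1) + k ≤
        (((p - k - 1 : ℕ) : ℚ) + 1) * (((p - k - 1 : ℕ) : ℚ) + 1 + k + k) := by
      nlinarith
    have hcore := coreDq ((k + 1).choose k : ℚ) ((k + 1 + 1).choose k : ℚ) ((p - k - 1 : ℕ) : ℚ) k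
      (((p - k - 1 : ℕ) : ℚ) + 1 + k + k) hX hXle hk0.le ha0 hkn
    split_ifs with h1 h2
    · exact hcore
    · rw [add_zero]
      refine le_trans ?_ hcore
      have : (0 : ℚ) ≤ (k : ℚ) * k * ((p - k - 1 : ℕ) : ℚ) / ((k + 1 + 1).choose k : ℚ) := by positivity
      linarith
    · exact absurd (by omega) h1
    · rw [zero_add, zero_add]
      positivity

/-- `dem(σ,j) ≤ ν(σ,j)` for `11 ≤ q ≤ 18` at every cell not in `excList`. -/
theorem dem_le_nuTerm_18 {p q k σ j : ℕ} (hq11 : 11 ≤ q) (hq : q ≤ 18) (hpq : q + 2 ≤ p) (hk1 : 1 ≤ k)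
    (hkq : k ≤ q) (hex : (p, q, k) ∉ excList) (hσ : σ ∈ Finset.Icc 1 k) (hj : j ∈ Finset.Icc 1 (p - q - 1)) :
    dem p q k σ j ≤ nuTerm p q k σ j := by
  rw [Finset.mem_Icc] at hσ hj
  have hjp : σ + j ≤ p := by omega
  unfold dem
  rcases Nat.lt_or_ge 1 σ with hσ2 | hσ1
  · rw [if_neg (by omega), zero_add]
    rcases Nat.lt_or_ge 1 j with hj2 | hj1
    · rw [if_neg (by omega), add_zero]
      exact demA_le_nuTerm hkq hj2 hjp
    · have hj1' : j = 1 := by omega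
      subst hj1'
      rw [if_pos rfl]
      refine demAC_le_nuTerm_of hpq hk1 hkq hσ2 hσ.2 ?_ ?_
      · intro hlt h3
        exact poly_I2_18 (p - k - 1) σ k q hq hlt hσ2 hσ.2 (by omega)
      · intro hlt h2
        exact poly_I2'_18 (p - k - 1) σ k q hq hlt hσ2 hσ.2 (by omega)
  · have hσ1' : σ = 1 := by omega
    subst hσ1'
    rw [if_pos rfl]
    rcases Nat.lt_or_ge 1 j with hj2 | hj1
    · rw [if_neg (by omega), add_zero]
      refine demBA_le_nuTerm_of hpq hk1 hkq hj2 hj.2 ?_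
      intro h3
      exact poly_I1_18 (p - k - j) j k q hq hk1 hkq hj2 (by omega)
    · have hj1' : j = 1 := by omega
      subst hj1'
      rw [if_pos rfl]
      refine demD_le_nuTerm_of hpq hk1 hkq ?_ ?_
      · intro hlt h4
        rcases Nat.lt_or_ge (p - k - 1) 11 with hsmall | hbig
        · have hp' : p - k - 1 + k + 1 = p := by omega
          have hnot : (p - k - 1 + k + 1, q, k) ∉ excList := by rw [hp']; exact hex
          exact poly_I3_18_small (p - k - 1) k q hq11 hq hk1 hlt (by omega) (by omega) (by omega) hnot
        · exact poly_I3_18_big (p - k - 1) k q hq hlt hbig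
      · intro hlt h3
        rcases Nat.lt_or_ge (p - k - 1) 11 with hsmall | hbig
        · have hp' : p - k - 1 + k + 1 = p := by omega
          have hnot : (p - k - 1 + k + 1, q, k) ∉ excList := by rw [hp']; exact hex
          exact poly_I3'_18_small (p - k - 1) k q hq11 hq hk1 hlt (by omega) (by omega) (by omega) hnot
        · exact poly_I3'_18_big (p - k - 1) k q hq hlt hbig

/-- **`num_ge` for `q ≤ 18`**: `Φ(p−1,q)·k ≤ NUM′(p,q,k)` for every `1 ≤ k ≤ q ≤ 18` and every `p ≥ q + 2`. -/
theorem num_ge_le_eighteen {p q k : ℕ} (hq : q ≤ 18) (hpq : q + 2 ≤ p) (hk1 : 1 ≤ k) (hkq : k ≤ q) :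
    phiK (p - 1) q * (k : ℚ) ≤ numPrime p q k := by
  rcases Nat.lt_or_ge q 11 with h10 | h11
  · exact num_ge_le_ten (by omega) hpq hk1 hkq
  · by_cases hex : (p, q, k) ∈ excList
    · exact num_ge_of_mem_excList hex
    · rw [mul_comm, numPrime_eq_sum_nuTerm]
      refine le_trans (mul_phiK_le_sum_dem hpq hk1 hkq) ?_
      apply Finset.sum_le_sum
      intro σ hσ
      apply Finset.sum_le_sum
      intro j hj
      exact dem_le_nuTerm_18 h11 hq hpq hk1 hkq hex hσ hj

/-- The hypothesis `hnum` of `avg_contract_le_of_num` / `exists_slack_contract_le_of_num`, for every `q ≤ 18`. -/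
theorem num_ge_of_le_eighteen {p q : ℕ} (hq : q ≤ 18) (hpq : q + 2 ≤ p) :
    ∀ k : ℕ, 1 ≤ k → k ≤ q → phiK (p - 1) q * (k : ℚ) ≤ numPrime p q k :=
  fun _ hk1 hkq => num_ge_le_eighteen hq hpq hk1 hkq

end PercRepro
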